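import Summits.HodgeConjecture.HodgeConjecture.Theorems.F0P2oXiLocalPacketThetaPairOfLetters   -- ★ p829745 B-p14 (g27): the Lines-free TWIN `xiLocalPacket_nonsplit_isThetaPair_of_letters (hN3) (hW) (hU1) (hN6) (hL)`
import Literature.NumberTheory.GelbartRogawski1991.XiLocalPacketNonsplitThetaPair              -- ★ p826161 typ-T7b (g0): THE TARGET LETTER #75-loc∕#104 `xiLocalPacket_nonsplit_isThetaPair` (BY NAME)
import Literature.NumberTheory.GelbartRogawski1991.ThetaTypeNonsplitJacquetModule              -- ★ p826177 typ-T7a (g0): THE N3 LETTER `thetaType_nonsplit_jacquetModule` (#96)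
import Literature.NumberTheory.Rogawski1990.U3PrincipalSeriesWeylConjugate                    -- ★ p826332 typ-T7a (g0): THE K1w LETTER `cmPrincipalSeries_isConstituentOf_weylConj` (#98)
import Literature.NumberTheory.GelbartRogawski1991.U1ThetaDichotomy                            -- ★ p826953∕p827180 typ-T7b (g0): THE U1 LETTER `u1ThetaDichotomy_nonsplit` (#97)
import Literature.NumberTheory.Rogawski1990.U3SupercuspidalJacquetCriterion                    -- ★ p826085 typ-T7a (g0): THE N6 LETTER `u3_isSupercuspidal_iff_jacquet_eq_zero` (row N6)
import Literature.NumberTheory.Automorphic.U3JacquetVanishingSupercuspidal   -- ★ p831380 A-p16 (g23) over ★ B-p17 (g21) (δ): `u3_isSupercuspidal_iff_jacquet_eq_zero_holds` — THE N6 LETTER PROVED IN-HOUSE (v1.1)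
import Literature.NumberTheory.Rogawski1990.U3SquareIntegrabilityExponentCriterion            -- ★ typ-T7b (g0): THE N7 LETTER `u3_squareIntegrable_jacquetExponent_decay` (row N7; BY NAME, v1.2)
import Summits.HodgeConjecture.HodgeConjecture.Theorems.F0P2pK1wHolds   -- ★ p833012 F0P2-p06 (g2): K1w HYPOTHESIS-FREE `cmPrincipalSeries_isConstituentOf_weylConj_holds` (over ★ p832032 + ★ p832625 N1), BY NAME (v1.4)
import Summits.HodgeConjecture.HodgeConjecture.Theorems.F0P2pGR91NOfN3   -- ★ p833094 F0P2-p06 (g2): `u1ThetaDichotomy_nonsplit_of_N3 (hN3)`, `GR91Lemma512NonsplitAsPrinted_of_N3 (hN3)` (U1 ∕ #76 modulo N3 only), BY NAME (v1.4)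
import Summits.HodgeConjecture.HodgeConjecture.Theorems.F0P2oN3OfTorusWeight   -- ★ p835661 F0P2-p06 (g3): THE N3 PACKAGER `thetaType_nonsplit_jacquetModule_of_a_of_torusWeight (hA) (hD)` over ★ p835430 (b)-assembler `F0P2oN3TorusWeightOfD3d`, BY NAME («N3 SPLIT», edition v1.5)
import Summits.HodgeConjecture.HodgeConjecture.Theorems.F0P2oN3TorusWeightHolds   -- ★ A-p16 (g24) (5c): `forall_jacquetModule_xThetaGqsCM_torus_eq_smul` = the packager՚s (hD) binder PROVED (token for token) ⇒ `stub_N3D_letter` closed BY NAME («N3D FOLD»)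
import Summits.HodgeConjecture.HodgeConjecture.Theorems.F0P2oLineJacquetHolds   -- ★ p839151 F0P2-p06 (g4) (JA): `thetaType_nonsplit_jacquetModule_holds : GelbartRogawski1991.thetaType_nonsplit_jacquetModule` HYPOTHESIS-FREE ⇒ `stub_N3_letter` closed BY NAME («N3 DIRECT FOLD»)
import Summits.HodgeConjecture.HodgeConjecture.Theorems.F0P2oN7OfCasselmanCriterion   -- ★ p835805 A-p13 (g27): Casselman՚s criterion ⇒ for the quasi-split `U(3)` at a non-split place over #109 N5 ★ p834912 — `u3_squareIntegrable_jacquetExponent_decay_holds`, HYPOTHESIS-FREE ⇒ `stub_N7_letter` closed BY NAME («N7 FOLD»; books #110 −1 at this REGISTERED edition)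
import Summits.HodgeConjecture.HodgeConjecture.Theorems.F0P2oThetaTypeNotL2   -- ★ p831648 B-p18 (g28): LABEL `thetaType_not_squareIntegrable (hN3) (hN6) (hN7)` (Lines-free Theorems file, BY NAME, v1.2)
import HarnessLib

/-!
# Crux `H413` (`stmt-HodgeConjecture-24833`), programme P2 — sub-line T7 `F0_P2XiLocalPacketThetaPair` «THE LOCAL THETA DICHOTOMY AT A NON-SPLIT PLACE»
# (edition v1.6 «N3 DIRECT FOLD» over v1.5 «N3 SPLIT + N3D FOLD + N7 FOLD» over v1.4 «N1 DROP + HOLDS FOLD» over v1.3 «N6 + LABEL + K1w + U1 FOLD» — the boxed pre-writes v1.1∕v1.2 are folded in and were never written — desk F0P2-plan (g9) over (g8), 2026-09-01; v1 46d3563480ea; director s616 (1): registered BY WRITE, no skeleton check — the registry of record for 24833 stays `a3_liu413`)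

Cell `hodgecm-mathlib`, F0∕P2, socket item 27455 (`hdictE`, road 27455), route `HCCMUnconditional` (no route verbs).  HONEST LABEL: HC_CM is proved only modulo the printed
citations until rung 0 closes; this file proves no letter — it CUTS the booked packet-level letter #75-loc∕#104 ★ `GelbartRogawski1991.xiLocalPacket_nonsplit_isThetaPair`
[GelbartRogawski1991 Lem. 5.1.2 p. 466; Cor. 5.2.2 p. 467; GelbartRogawski1990 Prop. 5.2.2] (typ-T7b (g0) p826161; the LOCAL HALF of D7α #75 `xiEnvelope_nonsplit_isThetaType`,
consumed by PKΠ `Cruxes/H413/Lines/F0_P2PKPiRung4.lean` through `stub_D7α` and by P3's L1′) into registered stubs that are PRINT LETTERS BY NAME, and kernel-checks the composition.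

## The cut (statement + stubs + kernel-checked composition, s554 shape)
* TARGET (§3 head, BY NAME): `xiLocalPacket_nonsplit_isThetaPair_of_stubs : GelbartRogawski1991.xiLocalPacket_nonsplit_isThetaPair` — for the CM frame, `ξ = (η, ψ)`, `μω`, a
  dictionary pair `(μ, χ_f)`, a NON-SPLIT finite place `v` and a form congruence: (n) some NON-square-integrable constituent `x₀` of `i_G(χ_ξ)` is the theta type
  `X_v(μ, εn, χ_f) ∘ κ_v⁻¹` and (s) some SUPERCUSPIDAL class `πs ≠ x₀ ∘ e` is the theta type `X_v(μ, εs, χ_f) ∘ κ_v⁻¹` — «`πⁿ(ξ_v) = Θ_{V⁺}`, `πˢ(ξ_v) = Θ_{V⁻}`».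
* COMPOSITION (§3, no `sorry`): ONE `exact` on the Lines-free `Theorems/` twin ★ p829745 `F0P2oXiLocalPacketThetaPairOfLetters.xiLocalPacket_nonsplit_isThetaPair_of_letters`
  (B-p14 (g27), row «T7-TWIN» dealt 17:18:23Z, ★ 17:26:42Z; = typ-T7b (g0)'s draft `F0/P2/Lines-draft/T7b_LocalThetaDichotomy.lean` v1.5 §3–§4 inlined over the seven ★
  closers BY NAME: K1 ★ p828142 `F0P2oThetaInPSOfLetters.stubThetaInPS_of_letters` (B-p18 (g28), p01, p02, p05, A-p12), K2 ★ p826011 `F0P2oStubDictTorusChar.stubDictTorusChar_holds`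
  (p02), SC ★ p829082 `F0P2oGR90Prop522OfLetters.GR90Prop522_of_letters` (B-p14; N4 ⟸ N3 + N6 over ★ N4-J p828592), GLUE-I ★ p828537 `F0P2oThetaCenterCharIndep` (p02), CLS ★ p828652
  `F0P2oThetaClassOfSupercuspidal` (p02), NE ★ p828800 `F0P2oSupercuspidalNeConstituent` (p02), OCC = ★ `u1Occurrence_exists_not` + GLUE-O ★ p827057 `F0P2oK1occ` (p01)).
* STUBS (§2, the ONLY `sorry`s of this file at v1.3 = {`stub_N3_letter`, `stub_N1_letter`, `stub_N7_letter`} — PRINT 3 ∕ ENGINE 0; `stub_N6_letter`, `stub_LABEL`, `stub_K1w_letter`, `stub_U1_letter` are PROVED BY NAME: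
  `stub_N3_letter` [GelbartRogawski1991 §3.2 (3.2.1)–(3.2.2) p. 457; Kudla1986 Thm. 2.8] (#96, ★ p826177), `stub_K1w_letter` [Rogawski1990 §12.1 p. 172, §12.2 p. 174;
  BernsteinZelevinsky1977 Thm. 2.9] (#98, ★ p826332) — ★ CLOSED BY NAME at v1.3 over p832032 F0P2-p06 (g0) `F0P2pK1wLetterOfN1.cmPrincipalSeries_isConstituentOf_weylConj_of_N1` fed `stub_N1_letter`, `stub_U1_letter` [HarrisKudlaSweet1996 Cor. 4.4; Rogawski1992 Prop. 3.4]
  (#97, ★ p826953∕p827180; DERIVED in-house ★ p829230 `F0P2oU1LetterOfTower.u1ThetaDichotomy_nonsplit_of_uniqueSub (hN3) (h4)` with ‹H4› = ★ p832406 B-p18 (g28)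
  `F0P2pPrincipalSeriesUniqueSubCM.principalSeries_uniqueSub (hN1)`) — ★ CLOSED BY NAME at v1.3 fed `stub_N3_letter`, `stub_N1_letter`; the new PRINT stub `stub_N1_letter` [Casselman1995
  Lemma 7.1.1 (a) p. 67, Thm. 6.3.5 p. 59; BernsteinZelevinsky1977 §2.12, Cor. 2.13 (c); Rogawski1990 §12.2 p. 173] (row #107, ★-typed typ-T3a) is the ONE common letter behind K1w and U1, `stub_N6_letter` [Rogawski1990 §12.2 p. 173, §1.10 p. 9; BernsteinZelevinsky1976 Thm. 3.21; Casselman1995 Thm. 5.3.1; GetzHahn2024 Thm. 8.3.3] (row N6,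
  ★ p826085) is ★ CLOSED BY NAME at v1.1 over `Rogawski1990.u3_isSupercuspidal_iff_jacquet_eq_zero_holds` (p831380, A-p16 (g23): ⇒ ★ p829792, ⇐ ★ p830400 unramified + ★ p830719 ray
  Jacquet criterion + B-p17 (g21)'s elementary Cartan decomposition for ANY involution (δ)) — no `sorry`; `stub_LABEL` = «`πⁿ` is not `L²`» is ★ CLOSED BY NAME at v1.2 over p831648 B-p18 (g28) `F0P2oThetaTypeNotL2.thetaType_not_squareIntegrable (hN3) (hN6) (hN7)` (conclusion = this stub token for
  token, 1726 = 1726, ref1 r184); the new PRINT stub is `stub_N7_letter` [Casselman1995 Thm. 4.4.6 (⇒); KatoTakano2009 p. 3; Rogawski1990 §12.2 (2) pp. 173–174] (row N7, ★-typed typ-T7b (g0)).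
  No `def`, no instance, no notation, no `Cruxes/…/Lines` import (house rule O50-1); axioms of the head = [propext, Classical.choice, Quot.sound] ⊕ `sorryAx` through the stubs only.

## Edition v1.6 «N3 DIRECT FOLD» (desk F0P2-plan (g9), 2026-09-01; proof-only for every SURVIVING statement, every surviving statement and head byte-unchanged; the clause-(a) stub `stub_N3a_letter` of v1.5 is DROPPED (N1-DROP precedent: its only consumer was the body of `stub_N3_letter`); supersedes v1.5 26eb96911c92).
The N3 letter #96 [GelbartRogawski1991 §3.2 (3.2.1)–(3.2.2) p. 457; Kudla1986 Thm. 2.8] `GelbartRogawski1991.thetaType_nonsplit_jacquetModule` — the LAST local print letter of programme P2 below the packet letters — is ★ CLOSED BY NAME, HYPOTHESIS-FREE, by the η-free (N′) line-Jacquet road: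
`stub_N3_letter := Summit.HodgeConjecture.HodgeConjecture.Cruxes.H413.F0P2oLineJacquetHolds.thetaType_nonsplit_jacquetModule_holds`
(★ p839151 F0P2-p06 (g4) `Theorems/F0P2oLineJacquetHolds.lean :: thetaType_nonsplit_jacquetModule_holds` (the (JA) junction over ★ (C5) p838835 B-p10 (g23), ★ (C6)∕(J1)–(J4) p838314 B-p14 (g29) + `F0P2oLineJacquetReindex`, ★ (BE) p838099∕p838184 B-p18 (g29), ★ (N′) p837961 F0P2-p06 (g4), ★ (LS) p836839, ★ (LM) p836568, ★ (FX)(CC) p837171∕p837965, ★ (BF) p837182, ★ (BD) p838316, ★ (IB) p838392, ★ (KL) p838305, ★ (SJ-gen) p838357; lead B-p18 (g29) socket (B) word 2026-08-31T23:47:37Z); conclusion = the Literature named fact BY NAME; the fold line elaborating is the certificate).  + import ★ `Theorems.F0P2oLineJacquetHolds`.  Sorry set of this file after v1.6: {} — the T7 sub-line is SORRY-FREE: `stub_N3_letter` (#96), `stub_U1_letter` (#97), `stub_LABEL` and the head `xiLocalPacket_nonsplit_isThetaPair_of_stubs` (#75-loc∕#104 `GelbartRogawski1991.xiLocalPacket_nonsplit_isThetaPair`)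 are THEOREMS of the tree HYPOTHESIS-FREE (axioms expected [propext, Classical.choice, Quot.sound], no `sorryAx`).  BOOKS: #96 N3 closes on the HYPOTHESIS-FREE Theorems-level proof of `GelbartRogawski1991.thetaType_nonsplit_jacquetModule` (director՚s pen, s527 criterion (i)); this edition is the consumer catch-up BY NAME.
HC_CM is proved only modulo the printed citations until rung 0 closes.

## Edition v1.5 «N3 SPLIT + N3D FOLD + N7 FOLD» (desk F0P2-plan (g8), 2026-08-31T22Z; director s705 DENOMINATION: #96 N3 stays ONE books row, re-denominated BY NAME to the packager՚s open print inputs; proof-only for every existing statement, heads byte-unchanged; supersedes v1.4 8e8104642623).  `stub_N3_letter` [GelbartRogawski1991 §3.2 (3.2.1)–(3.2.2) p. 457; Kudla1986 Thm. 2.8] is ★ CLOSED BY NAME over F0P2-p06 (g3)՚s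
★ p835661 `F0P2oN3OfTorusWeight.thetaType_nonsplit_jacquetModule_of_a_of_torusWeight stub_N3a_letter stub_N3D_letter` (packager over the ★ p835430 (b)-assembler `F0P2oN3TorusWeightOfD3d`: clause (b) of
the letter — the `m(γ)`-weight on `r_N(X_v)` read through the (D3d) undoubling∕coinvariant bricks ★ p834000 · p834249 · p835415 · p835416 · p835417 · p835587 · p835588 · p835613 (A-p16 (g24)) — is PROVED modulo
(hD); clause (a) is (hA)).  TWO NEW PRINT-RESIDUE STUBS, typed TOKEN FOR TOKEN as the packager՚s binders (extracted by script from the TREE bytes dc6083d4a23e6b99 of the ★ file, lines :83–:100 ∕ :101–:117,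
under its `open` ∕ `set_option` context via `set_option … in open … in`; the fold line elaborating is the fidelity certificate): `stub_N3a_letter` = clause (a) «`r_N(X_v(μ, ε, χ_f)) ≃ ℱ_v[ψθ]` as a `C`-line: the Borel
coinvariants of `X_v` are the `ψθ ∘ det`-weight space of the rank-one line Weil representation» [GelbartRogawski1991 §3.2 (3.2.1) p. 457; Kudla1986 Thm. 2.8 (top filtration piece = ev₀)] (in-house road, lead B-p18 (g29):
(S4) ★ p834408 ∘ CM closer ★ p832817 ∘ chart sockets ★ p834949∕p835111 (A-p12 (g17)) ∘ F0P2-p01 (g8)՚s (E1) ★ p835408 ∕ (E2) ∕ (E3) ★ p835407 ∕ (N) ∕ (W) dictionary; B-p18 (g29) 22:04:27Z rows (LS) local see-saw + (FN) frame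
naturality; B-p10 (g22) (1b) ★ p835647) and `stub_N3D_letter` = the torus weight «`m(γ)` acts on `r_N(X_v)` by `μ_w(γ)‖γ‖_w^{1/2}`» [Kudla1986 Thm. 2.8; Rogawski1990 §12.2 (2) p. 174] (in-house: A-p16 (g24)՚s (5b) CM-package
wrapper `Theorems/F0P2oThetaJacquetTorusWeight.lean` over ★ p835613 (5a) ⇒ ★ `F0P2oN3TorusWeightOfD3d.thetaType_nonsplit_jacquetModule_b_of_kerWeight`, ★ p835944; and (5c) ★ p836093 `F0P2oN3TorusWeightHolds.forall_jacquetModule_xThetaGqsCM_torus_eq_smul` PROVES the (hD) binder token for token ⇒ `stub_N3D_letter` is ★ CLOSED BY NAME in this edition — #96 N3 hinges on clause (a) ALONE).  «N7 FOLD» in the same write: `stub_N7_letter` [Casselman1995 Thm. 4.4.6 (⇒); Rogawski1990 §12.2 (2) pp. 173–174] := ★ p835805 A-p13 (g27) `F0P2oN7OfCasselmanCriterion.u3_squareIntegrable_jacquetExponent_decay_holds` (HYPOTHESIS-FREE over #109 N5 ★ p834912 `F0P3U3SquareIntegrableExponentsHolds`; by-import tie GREEN A-p13 22:38:00Z) —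 books #110 N7 UNPROVED −1 at this REGISTERED edition (director՚s fold).  Sorry set of this file after v1.5: {`stub_N3a_letter`} — PRINT 1 (clause (a) of #96) ∕ ENGINE 0.
HC_CM is proved only modulo the printed citations until rung 0 closes.

## Edition v1.4 «N1 DROP + HOLDS FOLD» (F0P2-plan (g8); proof-only, count-neutral except as noted)
`stub_N1_letter` (#107, ★ CLOSED on the P3b side p832625) is DELETED — no consumer is left: `stub_K1w_letter := ★ p833012 F0P2-p06 (g2) `F0P2pK1wHolds.cmPrincipalSeries_isConstituentOf_weylConj_holds`
(HYPOTHESIS-FREE K1w) and `stub_U1_letter := ★ p833094 F0P2-p06 (g2) `F0P2pGR91NOfN3.u1ThetaDichotomy_nonsplit_of_N3 stub_N3_letter` (U1 modulo N3 only; inside: ★ p829230 tower ∘ ★ p832559 CM head ∘ ★ p832625 N1).  Imports: − the four v1.3-fold modules (now reached transitively through ★ p833094), + ★ p833012, + ★ p833094.  REGISTERED SORRY SET v1.4 = {`stub_N3_letter` (#96), `stub_N7_letter` (#110)}; every statement and the head are BYTE-IDENTICAL to the previous edition.  HC_CM is proved only modulo the printed citations until rung 0 closes.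

## Books (director s616 (2), by name against v7.59)
#104 (D) CLOSES «derived by name» from {#96 N3, #98 K1w, #97 U1, row N6 (+1 at v1; ★ DISCHARGED in-house, −1), row N7 (+1 at v1.2∕v1.3: LABEL ★ in-house modulo N3∕N6∕N7), row #107 N1 (already booked; K1w and U1 ★ DERIVED from it at v1.3, −2)} + the ★ twin — the UNPROVED
headline does not drop on this move; what it buys is CURRENCY: Gelbart–Rogawski's packet-level letter is replaced by rank-one∕`U(3)` textbook statements, and D leaves L1′'s
and PKΠ's letter lists by name.  HC_CM is proved only modulo the printed citations until rung 0 closes.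
-/

set_option autoImplicit false
-- the mandated namespace has the single-problem summit's repeated segment (`HodgeConjecture.HodgeConjecture`)
set_option linter.dupNamespace false

noncomputable section

open NumberField IsDedekindDomain MeasureTheory
open scoped Matrix

open Literature.NumberTheory Literature.NumberTheory.Automorphic Literature.NumberTheory.Automorphic.UnitaryGroup
open Literature.NumberTheory.Automorphic.IdeleClassGroup
open Literature.NumberTheory.Automorphic.Liu2021 Literature.NumberTheory.Automorphic.Liu2021.Def411WeilCarriers
open Literature.NumberTheory.GaloisRepresentations
open Literature.NumberTheory.Rogawski1990
open Literature.NumberTheory.GelbartRogawski1991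

namespace Summit.HodgeConjecture.HodgeConjecture.Cruxes.H413.F0P2XiLocalPacketThetaPair

/-! ## §1 The target BY NAME: ★ `GelbartRogawski1991.xiLocalPacket_nonsplit_isThetaPair` (#75-loc∕#104; no Lines-local restatement — the letter's body is typ-T7b's
`D7alphaLocalTarget` token for token, ref1 r176). [cite: GelbartRogawski1991, Lem. 5.1.2 p. 466; Cor. 5.2.2 p. 467] -/

/-! ## §2 The stubs (`sorry` = open; print letters BY NAME) -/

set_option synthInstance.maxHeartbeats 400000 in
set_option maxHeartbeats 16000000 in
open NumberField IsDedekindDomain MeasureTheory Literature.NumberTheory Literature.NumberTheory.Automorphic Literature.NumberTheory.Automorphic.UnitaryGroup Literature.NumberTheory.Automorphic.IdeleClassGroup Literature.NumberTheory.Automorphic.Liu2021 Literature.NumberTheory.Automorphic.Liu2021.Def411WeilCarriers Literature.NumberTheory.Automorphic.Liu2021.Def411WeilCarriersDoubling Literature.NumberTheory.GelbartRogawski1991.UnitaryDualPair Literature.NumberTheory.GelbartRogawski1991.UnitaryDualPair.WeilCoinv Literature.RepresentationTheory.Liu2021 Literature.NumberTheory.GaloisRepresentations Literature.NumberTheory.Rogawski1990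 Literature.NumberTheory.GelbartRogawski1991 Literature.RepresentationTheory Summit.HodgeConjecture.HodgeConjecture.Cruxes.H413.F0P2oN3TorusWeightOfD3d in
/-- **N3 (D) — the torus weight on the Jacquet module, ∀-closed — ★ CLOSED BY NAME** over A-p16 (g24)՚s (5c) ★ p836093 `F0P2oN3TorusWeightHolds.forall_jacquetModule_xThetaGqsCM_torus_eq_smul` (over (5b) ★ p835944 + the (D3d) bricks; edition v1.5; no `sorry`): «the diagonal torus element `m(γ) = d(γ, 1, γ̄⁻¹)` (`torusEntry … 1 t = 1`) acts on
`r_N(X_v(μ, ε, χ_f))` by `μ_w(γ)·‖γ‖_w^{1/2}` (`(toHeckeCharacter L μ).semilocalComponent L v γ * halfModulusChar _ γ`)» [Kudla1986 Thm. 2.8; Rogawski1990 §12.2 (2) p. 174; GelbartRogawski1991 §3.2 (3.2.2)].  TEXT = the binder `hD`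
of ★ p835661 TOKEN FOR TOKEN (tree lines :101–:117).  In-house road (D): A-p16 (g24)՚s (5b) CM-package wrapper `Theorems/F0P2oThetaJacquetTorusWeight.lean` ⇒ ★ `F0P2oN3TorusWeightOfD3d.thetaType_nonsplit_jacquetModule_b_of_kerWeight`. -/
theorem stub_N3D_letter :
    ∀ (L : Type) [Field L] [NumberField L] [IsCMField L]
      {n' : ℕ} (e₁ : Fin 3 × Fin 1 ≃ Fin n') (dV : Fin 3 → L) (hdV : ∀ i, IsCMField.complexConj L (dV i) = dV i) (hdV0 : ∀ i, dV i ≠ 0)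
      (μ : Literature.NumberTheory.Automorphic.IdeleClassGroup L →ₜ* Circle) (hμ : IsConjugateSymplectic L μ)
      (χf : UnitaryGroup.finAdelicOne (↥(maximalRealSubfield L)) L (IsCMField.complexConj L) →* ℂˣ),
      Continuous χf → (∀ z, ‖((χf z : ℂˣ) : ℂ)‖ = 1) →
      ∀ (v : HeightOneSpectrum (𝓞 ↥(maximalRealSubfield L))),
        (∀ w : PlacesOver L v, IsCMField.complexConj L • w.1 = w.1) →
        ∀ (ε : (↥(maximalRealSubfield L))ˣ)
          (T : GL (Fin 3) (UnitaryGroup.LocalRing L v)) (a : UnitaryGroup.LocalRing L v) (ha : IsUnit a)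
          (h : formCongr (conjLocal L (IsCMField.complexConj L) v) T ((Matrix.diagonal dV).map (algebraMap L (UnitaryGroup.LocalRing L v))) =
            a • (Matrix.of fun i j : Fin 3 => if i.val + j.val + 1 = 3 then (1 : L) else 0).map (algebraMap L (UnitaryGroup.LocalRing L v)))
          (t : ↥(cmBorelTriple L 3 v).M),
          torusEntry (conjLocal L (IsCMField.complexConj L) v) (cmLocalForm L 3 v) 1 t = 1 →
          ∀ x : ((cmBorelTriple L 3 v).restrict (xThetaGqsCM L e₁ dV hdV hdV0 μ hμ χf ε v T ha h)).Coinvariants,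
            Representation.jacquetModule (xThetaGqsCM L e₁ dV hdV hdV0 μ hμ χf ε v T ha h) (cmBorelTriple L 3 v) t x =
              (((toHeckeCharacter L μ).semilocalComponent L v (torusEntry (conjLocal L (IsCMField.complexConj L) v) (cmLocalForm L 3 v) 0 t) *
                  halfModulusChar (UnitaryGroup.LocalRing L v) (torusEntry (conjLocal L (IsCMField.complexConj L) v) (cmLocalForm L 3 v) 0 t) : ℂˣ) : ℂ) • x :=
  Summit.HodgeConjecture.HodgeConjecture.Cruxes.H413.F0P2oN3TorusWeightHolds.forall_jacquetModule_xThetaGqsCM_torus_eq_smul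

/-- **THE N3 LETTER — ★ CLOSED BY NAME, HYPOTHESIS-FREE** (edition v1.6 «N3 DIRECT FOLD» over ★ p839151 F0P2-p06 (g4) `Theorems/F0P2oLineJacquetHolds.lean :: thetaType_nonsplit_jacquetModule_holds` (the (JA) junction over ★ (C5) p838835 B-p10 (g23), ★ (C6)∕(J1)–(J4) p838314 B-p14 (g29) + `F0P2oLineJacquetReindex`, ★ (BE) p838099∕p838184 B-p18 (g29), ★ (N′) p837961 F0P2-p06 (g4), ★ (LS) p836839, ★ (LM) p836568, ★ (FX)(CC) p837171∕p837965, ★ (BF) p837182, ★ (BD) p838316, ★ (IB) p838392, ★ (KL) p838305, ★ (SJ-gen) p838357; lead B-p18 (g29) socket (B) word 2026-08-31T23:47:37Z) — the η-free (N′) line-Jacquet road; the clause-(a) stub `stub_N3a_letter` of v1.5 is DROPPED, `stub_N3D_letter` stays ★ by name; WAS: (D) proved in tree; edition v1.5 over ★ p835661 `F0P2oN3OfTorusWeight.thetaType_nonsplit_jacquetModule_of_a_of_torusWeight stub_N3a_letter stub_N3D_letter`; the whole letter was a print letter by name before) — (#96): [GelbartRogawski1991 §3.2 (3.2.1)–(3.2.2)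 p. 457; Kudla1986 Thm. 2.8] — the Jacquet module of the local theta type at a
non-split place, ★-typed p826177 (typ-T7a (g0)) `Literature/NumberTheory/GelbartRogawski1991/ThetaTypeNonsplitJacquetModule.lean`. Statement unchanged; no `sorry`. -/
theorem stub_N3_letter : Literature.NumberTheory.GelbartRogawski1991.thetaType_nonsplit_jacquetModule :=
  Summit.HodgeConjecture.HodgeConjecture.Cruxes.H413.F0P2oLineJacquetHolds.thetaType_nonsplit_jacquetModule_holds

/-- **THE K1w LETTER — ★ CLOSED BY NAME, HYPOTHESIS-FREE (edition v1.4 over ★ p833012 `F0P2pK1wHolds.cmPrincipalSeries_isConstituentOf_weylConj_holds`; was over N1 at v1.3)** (row #98): [Rogawski1990 §12.1 p. 172, §12.2 p. 174; BernsteinZelevinsky1977 Thm. 2.9] —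
«`JH(i_G(χ)) = JH(i_G(wχ))`» for the quasi-split `U(3)` principal series, ★-typed p826332 (typ-T7a (g0)) `Literature/NumberTheory/Rogawski1990/U3PrincipalSeriesWeylConjugate.lean`,
PROVED IN-HOUSE modulo the one print letter N1 by F0P2-p06 (g0)'s K1w pay-down chain ★ F1 p827152 · F2 p828054 · F3a p828055 · F3b p828796 · F4a p829088 · F4b p829948 ·
F4c p832032 `F0P2pK1wLetterOfN1.cmPrincipalSeries_isConstituentOf_weylConj_of_N1 (hN1)` (N6 discharged inside by ★ p831380; twin B-p17 (g21); ref1 r187 (2)).  Statement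
unchanged (the letter BY NAME); no `sorry`. -/
theorem stub_K1w_letter : Literature.NumberTheory.Rogawski1990.cmPrincipalSeries_isConstituentOf_weylConj :=
  Summit.HodgeConjecture.HodgeConjecture.Cruxes.H413.F0P2pK1wHolds.cmPrincipalSeries_isConstituentOf_weylConj_holds

/-- **THE U1 LETTER — ★ CLOSED BY NAME MODULO N3 ONLY (edition v1.4 over ★ p833094 `F0P2pGR91NOfN3.u1ThetaDichotomy_nonsplit_of_N3 stub_N3_letter`; was over N3 + N1 at v1.3)** (row #97): [HarrisKudlaSweet1996 Cor. 4.4 p. 962; Rogawski1992 Prop. 3.4] — the `(U(1),U(1))` theta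
dichotomy at a non-split place in CM normalisation, ★-typed p826953∕ED. 2 p827180 (typ-T7b (g0)) `Literature/NumberTheory/GelbartRogawski1991/U1ThetaDichotomy.lean`,
PROVED IN-HOUSE «up the tower» modulo the print letters N3 and N1: ★ p829230 B-p18 (g28) `F0P2oU1LetterOfTower.u1ThetaDichotomy_nonsplit_of_uniqueSub (hN3) (h4)`
(road (T): ★ p828521 U1-DISJOINT of tower, ★ p828329 A-p12 (g16) dichotomy of disjoint, ★ p829029 step (1), ★ p829024 F0P2-p05 (g0) step (5)) with ‹h4› = the CM HEAD
★ p832406 B-p18 (g28) `F0P2pPrincipalSeriesUniqueSubCM.principalSeries_uniqueSub (hN1)` («at most one irreducible subrepresentation of `i_G(χ)`, `χ ≠ wχ`»;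
★ p831178 F0P2-p02 (g6) generic `areIsomorphicRep_of_intertwiningMap_normalizedInd_ne_zero` + ★ p831282 F0P2-p06 (g0) N1 unfold; [Casselman1995 Lemma 7.1.1 (a), Thm. 6.3.5;
BernsteinZelevinsky1977 Prop. 1.9, Thm. 2.4 (b); Rogawski1990 §12.2 pp. 173–174]).  Statement unchanged (the letter BY NAME); no `sorry`. -/
theorem stub_U1_letter : Literature.NumberTheory.GelbartRogawski1991.u1ThetaDichotomy_nonsplit :=
  Summit.HodgeConjecture.HodgeConjecture.Cruxes.H413.F0P2pGR91NOfN3.u1ThetaDichotomy_nonsplit_of_N3 stub_N3_letter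

/-- **THE N6 PRINT LETTER BY NAME** (row N6): [Rogawski1990 §12.2 p. 173; §1.10 p. 9; BernsteinZelevinsky1976 Thm. 3.21; Casselman1995 Thm. 5.3.1; HarishChandra1970 Part I §3;
GetzHahn2024 Def. 8.1, Thm. 8.3.3] — «supercuspidal ⟺ zero Jacquet module» for the quasi-split `U(3)` at a non-split place, ★-typed p826085 (typ-T7a (g0))
`Literature/NumberTheory/Rogawski1990/U3SupercuspidalJacquetCriterion.lean`; ⇒ half ★ p829792 `u3_isSupercuspidal_iff_jacquet_eq_zero_mp` (A-p16 (g23)), ⇐-unramified in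
flight at v1 — ★ CLOSED BY NAME at v1.1 (p831380 `U3JacquetVanishingSupercuspidal`: ⇐ at EVERY non-split place, ramified and dyadic included, over B-p17 (g21)'s
elementary Cartan decomposition `UnitaryGroup.exists_cartan_of_involution` and A-p16 (g23)'s ray Jacquet criterion ★ p830719). No `sorry`. -/
theorem stub_N6_letter : Literature.NumberTheory.Rogawski1990.u3_isSupercuspidal_iff_jacquet_eq_zero :=
  Literature.NumberTheory.Rogawski1990.u3_isSupercuspidal_iff_jacquet_eq_zero_holds

/-- **THE N7 LETTER — ★ CLOSED BY NAME, HYPOTHESIS-FREE** (edition v1.5 «N7 FOLD» over ★ p835805 A-p13 (g27) `F0P2oN7OfCasselmanCriterion.u3_squareIntegrable_jacquetExponent_decay_holds` — Casselman՚s criterion ⇒ over #109 N5 ★ p834912; books #110 −1 at this REGISTERED edition; row N7, a print letter by name before): [Casselman1995 Thm. 4.4.6 (⇒), as restated in KatoTakano2009 p. 3; Rogawski1990 §12.2 (2) pp. 173–174] — Casselman's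
square-integrability criterion for the quasi-split `U(3)` at a non-split place (Borel–Jacquet quotient exponents of a square-integrable representation decay on the
dominant cone), ★-typed by typ-T7b (g0): `Literature/NumberTheory/Rogawski1990/U3SquareIntegrabilityExponentCriterion.lean` (`def … : Prop`). Statement unchanged; no `sorry`. -/
theorem stub_N7_letter : Literature.NumberTheory.Rogawski1990.u3_squareIntegrable_jacquetExponent_decay :=
  Summit.HodgeConjecture.HodgeConjecture.Cruxes.H413.F0P2oN7OfCasselmanCriterion.u3_squareIntegrable_jacquetExponent_decay_holds

set_option synthInstance.maxHeartbeats 400000 in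
set_option maxHeartbeats 8000000 in
/-- **LABEL — `πⁿ` is NOT square-integrable — ★ CLOSED BY NAME (v1.2)** over ★ p831648 B-p18 (g28) `F0P2oThetaTypeNotL2.thetaType_not_squareIntegrable (hN3) (hN6) (hN7)`:
N3's raw Borel–Jacquet exponent of modulus `‖α‖^{1/2}` against Casselman's criterion N7, with N6 supplying «a constituent of `i_G(χ_ξ)` has non-zero Jacquet module» at
every non-split `v` [Casselman1995 Thm. 4.4.6; Rogawski1990 §12.2 (2) p. 174].  Statement = the `hL` binder of the ★ twin p829745 token for token (unchanged from v1);
LABEL (ENGINE) thereby LEAVES the registered set and the PRINT letter N7 enters it. -/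
theorem stub_LABEL :
    ∀ (L : Type) [Field L] [NumberField L] [IsCMField L] (H : Matrix (Fin 3) (Fin 3) L) (hH : (H.map (cmConjRingHom L))ᵀ = H) (hHd : IsUnit H.det)
      {n' : ℕ} (e₁ : Fin 3 × Fin 1 ≃ Fin n') (dV : Fin 3 → L) (hdV : ∀ i, IsCMField.complexConj L (dV i) = dV i) (hdV0 : ∀ i, dV i ≠ 0) (g : GL (Fin 3) L)
      (hg : ((g : Matrix (Fin 3) (Fin 3) L).map (cmConjRingHom L))ᵀ * H * (g : Matrix (Fin 3) (Fin 3) L) = Matrix.diagonal dV),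
      ∀ (μ : Literature.NumberTheory.Automorphic.IdeleClassGroup L →ₜ* Circle) (hμ : IsConjugateSymplectic L μ)
        (χf : UnitaryGroup.finAdelicOne (↥(maximalRealSubfield L)) L (IsCMField.complexConj L) →* ℂˣ),
        Continuous χf → (∀ z, ‖((χf z : ℂˣ) : ℂ)‖ = 1) →
        ∀ (v : HeightOneSpectrum (𝓞 ↥(maximalRealSubfield L))),
          (∀ w : PlacesOver L v, IsCMField.complexConj L • w.1 = w.1) →
          ∀ (T : GL (Fin 3) (UnitaryGroup.LocalRing L v)) (a : UnitaryGroup.LocalRing L v) (ha : IsUnit a)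
            (h : formCongr (conjLocal L (IsCMField.complexConj L) v) T (H.map (algebraMap L (UnitaryGroup.LocalRing L v))) =
              a • (Matrix.of fun i j : Fin 3 => if i.val + j.val + 1 = 3 then (1 : L) else 0).map (algebraMap L (UnitaryGroup.LocalRing L v)))
            (ε : (↥(maximalRealSubfield L))ˣ) (x₀ : IrrClass (Gqs L v)) (ψθ : ↥(normOneUnits (conjLocal L (IsCMField.complexConj L) v)) →* ℂˣ),
            IsThetaCenterChar L μ χf ε v ψθ →
            x₀.IsConstituentOf (cmPrincipalSeries L 3 v (cmXiTorusChar L v ((toHeckeCharacter L μ).semilocalComponent L v) ψθ⁻¹ ψθ)) →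
            ThetaTypeAtCM L H e₁ dV hdV hdV0 g hg μ hμ χf ε v (IrrClass.comap (cmDatumLocalCongr L v T ha h).symm x₀) →
            ∀ [MeasurableSpace (Gqs L v ⧸ Subgroup.center (Gqs L v))] [BorelSpace (Gqs L v ⧸ Subgroup.center (Gqs L v))]
              (μZ : Measure (Gqs L v ⧸ Subgroup.center (Gqs L v))) [μZ.IsHaarMeasure], ¬ x₀.IsSquareIntegrable μZ :=
  Summit.HodgeConjecture.HodgeConjecture.Cruxes.H413.F0P2oThetaTypeNotL2.thetaType_not_squareIntegrable stub_N3_letter stub_N6_letter stub_N7_letter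

/-! ## §3 The composition (no `sorry`): the registered stubs give the letter BY NAME -/

set_option synthInstance.maxHeartbeats 400000 in
set_option maxHeartbeats 8000000 in
/-- **THE ONE CONCLUDER BY NAME**: the stubs {N3, N7 (open) · K1w (★ over N1), U1 (★ over N3∕N1), N6 (★), LABEL (★ over N3∕N6∕N7)} compose to #75-loc∕#104 `GelbartRogawski1991.xiLocalPacket_nonsplit_isThetaPair` through the ★ twin
p829745 — kernel-checked, no `sorry` in this declaration. [cite: GelbartRogawski1991, Lem. 5.1.2 p. 466; Cor. 5.2.2 p. 467] [cite: GelbartRogawski1990, Prop. 5.2.2] -/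
theorem xiLocalPacket_nonsplit_isThetaPair_of_stubs : Literature.NumberTheory.GelbartRogawski1991.xiLocalPacket_nonsplit_isThetaPair :=
  Summit.HodgeConjecture.HodgeConjecture.Cruxes.H413.F0P2oXiLocalPacketThetaPairOfLetters.xiLocalPacket_nonsplit_isThetaPair_of_letters
    stub_N3_letter stub_K1w_letter stub_U1_letter stub_N6_letter stub_LABEL

end Summit.HodgeConjecture.HodgeConjecture.Cruxes.H413.F0P2XiLocalPacketThetaPair

end
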